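import Literature.AlgebraicGeometry.Resolution.NormalAscent
import Literature.AlgebraicGeometry.Resolution.GeometricallyRegularFG
import Literature.AlgebraicGeometry.Resolution.ExcellentRingsEssFiniteType
import Literature.AlgebraicGeometry.Resolution.ExcellentRingsFieldProofs
import Mathlib.RingTheory.AdicCompletion.LocalRing
import HarnessLib

/-!
# Analytic normality (Stacks 0C23) and Cossart–Piltant's "`T'_{P'}` is also normal"

Topic: `Literature/AlgebraicGeometry/Resolution`. Corollaries of the local form of Stacks 0BFK
proved in `NormalAscent.lean` (`IsRegularHom.isDomain_and_isIntegrallyClosed`: normality ascends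
along regular homomorphisms from a Noetherian normal domain to a Noetherian local ring):

* `IsGRing.isDomain_and_isIntegrallyClosed_adicCompletion` — **Stacks 0C23 / Zariski's analytic
  normality**: the completion of a normal Noetherian local G-ring (e.g. a quasi-excellent normal
  local domain) is a normal domain; with the quasi-excellent, excellent and
  essentially-of-finite-type-over-a-field cases, and the local rings `B_𝔭` of normal domains
  of finite type over a field (Zariski 1950: normal points of algebraic varieties are
  analytically normal, in particular analytically irreducible);
* `isDomain_and_isIntegrallyClosed_localization_tensor_adicCompletion` — **Cossart–Piltant
  2019, proof of Prop. 4.8 (arXiv v1 Prop. 4.6, p. 53): "Since `T_P` is normal, `T'_{P'}` is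
  also normal ibid. [EGA IV 7.9.3.1] and (7.8.3)(v)"**, for `T' = T ⊗_A Â` with `A` a Noetherian
  local G-ring, `T` essentially of finite type over `A`, `P' ⊂ T'` a prime over `P ⊂ T`:
  if `T_P` is an integrally closed domain, so is `T'_{P'}`. (`T → T ⊗_A Â` is regular as the
  base change of the regular `A → Â` along the essentially finite type `A → T`, Stacks 07C1,
  `IsRegularHom.baseChange_of_essFiniteType`; localise source and target.)

Everything is PROVED; no definitions, no named facts.

## Sources

* The Stacks Project, Tags 0C23, 0BFK, 07C1. [StacksProject]
* O. Zariski, *Sur la normalité analytique des variétés normales*, Ann. Inst. Fourier 2 (1950)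
  161–164.
* V. Cossart, O. Piltant, J. Algebra 529 (2019) 268–535 = arXiv:1412.0868, proof of Prop. 4.8
  (arXiv v1: Prop. 4.6, p. 53). [CossartPiltant2019]
-/

noncomputable section

open IsLocalRing TensorProduct

namespace Literature.AlgebraicGeometry.Resolution

universe u

/-! ## Completions of normal local G-rings (Stacks 0C23) -/

section Completion

variable {A : Type u} [CommRing A] [IsLocalRing A] [IsDomain A] [IsIntegrallyClosed A]

/-- **Stacks 0C23 — analytic normality of normal local G-rings**: the completion of a normal
Noetherian local G-ring is an integrally closed domain (`A → Â` is regular,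
`IsGRing.isRegularHom_adicCompletion`, and normality ascends along regular maps to local rings,
`IsRegularHom.isDomain_and_isIntegrallyClosed`). [cite: StacksProject, Tag 0C23] -/
theorem IsGRing.isDomain_and_isIntegrallyClosed_adicCompletion (hA : IsGRing A) :
    IsDomain (AdicCompletion (maximalIdeal A) A) ∧
      IsIntegrallyClosed (AdicCompletion (maximalIdeal A) A) := by
  haveI : IsNoetherianRing A := hA.1
  haveI : IsNoetherianRing (AdicCompletion (maximalIdeal A) A) :=
    isNoetherianRing_adicCompletion_maximalIdeal A
  exact hA.isRegularHom_adicCompletion.isDomain_and_isIntegrallyClosed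

/-- The completion of a quasi-excellent normal local domain is a normal domain ("for example if
`A` is excellent or quasi-excellent", Stacks 0C23). [cite: StacksProject, Tag 0C23] -/
theorem IsQuasiExcellentRing.isDomain_and_isIntegrallyClosed_adicCompletion
    (hA : IsQuasiExcellentRing A) :
    IsDomain (AdicCompletion (maximalIdeal A) A) ∧
      IsIntegrallyClosed (AdicCompletion (maximalIdeal A) A) :=
  hA.isGRing.isDomain_and_isIntegrallyClosed_adicCompletion

/-- The completion of an excellent normal local domain is a normal domain.
[cite: StacksProject, Tag 0C23] -/
theorem IsExcellentRing.isDomain_and_isIntegrallyClosed_adicCompletion (hA : IsExcellentRing A) :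
    IsDomain (AdicCompletion (maximalIdeal A) A) ∧
      IsIntegrallyClosed (AdicCompletion (maximalIdeal A) A) :=
  hA.isQuasiExcellentRing.isDomain_and_isIntegrallyClosed_adicCompletion

/-- **Zariski's analytic normality for local rings essentially of finite type over a field**:
such a ring, if a normal domain, has a normal domain as completion (it is excellent,
`Stacks07QW_field_holds`, `IsExcellentRing.of_essFiniteType`). [cite: StacksProject, Tag 0C23] -/
theorem isDomain_and_isIntegrallyClosed_adicCompletion_of_essFiniteType (k : Type u) [Field k]
    [Algebra k A] (h : Algebra.EssFiniteType k A) :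
    IsDomain (AdicCompletion (maximalIdeal A) A) ∧
      IsIntegrallyClosed (AdicCompletion (maximalIdeal A) A) :=
  have hk : IsExcellentRing k := Stacks07QW_field_holds k k inferInstance
  (hk.of_essFiniteType h).isDomain_and_isIntegrallyClosed_adicCompletion

end Completion

/-- **Normal points of algebraic varieties are analytically normal (Zariski 1950)**: for an
algebra `B` of finite type over a field and a prime `𝔭` with `B_𝔭` an integrally closed domain,
the completion of `B_𝔭` is an integrally closed domain (in particular `B_𝔭` is analytically
irreducible). [cite: StacksProject, Tag 0C23] -/
theorem isDomain_and_isIntegrallyClosed_adicCompletion_localization_atPrime (k : Type u)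
    [Field k] {B : Type u} [CommRing B] [Algebra k B] [Algebra.FiniteType k B] (p : Ideal B)
    [p.IsPrime] [IsDomain (Localization.AtPrime p)]
    [IsIntegrallyClosed (Localization.AtPrime p)] :
    IsDomain (AdicCompletion (maximalIdeal (Localization.AtPrime p)) (Localization.AtPrime p)) ∧
      IsIntegrallyClosed
        (AdicCompletion (maximalIdeal (Localization.AtPrime p)) (Localization.AtPrime p)) :=
  have hB : IsExcellentRing B := Stacks07QW_field_holds k B inferInstance
  (hB.of_isLocalization (B := Localization.AtPrime p)
    p.primeCompl).isDomain_and_isIntegrallyClosed_adicCompletion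

/-! ## Cossart–Piltant: `T'_{P'}` is normal -/

section CossartPiltant

variable {A : Type u} [CommRing A] [IsLocalRing A]

/-- **Cossart–Piltant 2019, proof of Prop. 4.8: "Since `T_P` is normal, `T'_{P'}` is also
normal"** (`T' = T ⊗_A Â`; EGA IV 7.8.3 (v)). For a Noetherian local G-ring `A` (e.g.
quasi-excellent), an `A`-algebra `T` essentially of finite type, and a prime `P'` of
`T' = T ⊗_A Â` over a prime `P` of `T` with `T_P` an integrally closed domain, the local ring
`T'_{P'}` is an integrally closed domain: `T → T'` is regular (base change of the regular
`A → Â` along `A → T`, Stacks 07C1), hence so is `T_P → T'_{P'}`, and normality ascends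
(`IsRegularHom.isDomain_and_isIntegrallyClosed`).
[cite: CossartPiltant2019, proof of Prop. 4.8 (arXiv v1: Prop. 4.6, p. 53)]
[cite: StacksProject, Tag 0BFK] [cite: StacksProject, Tag 07C1] -/
theorem isDomain_and_isIntegrallyClosed_localization_tensor_adicCompletion (hA : IsGRing A)
    {T : Type u} [CommRing T] [Algebra A T] [Algebra.EssFiniteType A T] (P : Ideal T) [P.IsPrime]
    (P' : Ideal (T ⊗[A] AdicCompletion (maximalIdeal A) A)) [P'.IsPrime] [P'.LiesOver P]
    [IsDomain (Localization.AtPrime P)] [IsIntegrallyClosed (Localization.AtPrime P)] :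
    IsDomain (Localization.AtPrime P') ∧ IsIntegrallyClosed (Localization.AtPrime P') := by
  haveI : IsNoetherianRing A := hA.1
  set Ah := AdicCompletion (maximalIdeal A) A
  haveI : IsNoetherianRing Ah := isNoetherianRing_adicCompletion_maximalIdeal A
  haveI : IsNoetherianRing T := Algebra.EssFiniteType.isNoetherianRing A T
  -- `T' = T ⊗_A Â` is Noetherian (essentially of finite type over `Â`)
  haveI : IsNoetherianRing (T ⊗[A] Ah) := by
    haveI : IsNoetherianRing (Ah ⊗[A] T) := Algebra.EssFiniteType.isNoetherianRing Ah (Ah ⊗[A] T)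
    exact isNoetherianRing_of_ringEquiv (Ah ⊗[A] T) (Algebra.TensorProduct.comm A Ah T).toRingEquiv
  -- `T → T'` is regular (Stacks 07C1), hence `T → T'_{P'}` and `T_P → T'_{P'}`
  have h1 : IsRegularHom T (T ⊗[A] Ah) :=
    hA.isRegularHom_adicCompletion.baseChange_of_essFiniteType T
  set C := Localization.AtPrime P'
  have h2 : IsRegularHom T C := h1.comp_isLocalization_right P'.primeCompl C
  set TP := Localization.AtPrime P
  letI : Algebra TP C := Localization.AtPrime.algebraOfLiesOver P P'
  have h3 : IsRegularHom TP C := IsRegularHom.of_isLocalization_left P.primeCompl TP C h2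
  haveI : IsNoetherianRing TP := IsLocalization.isNoetherianRing P.primeCompl TP inferInstance
  haveI : IsNoetherianRing C := IsLocalization.isNoetherianRing P'.primeCompl C inferInstance
  exact h3.isDomain_and_isIntegrallyClosed

end CossartPiltant

end Literature.AlgebraicGeometry.Resolution
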